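import Literature.Analysis.FluidPDE.AxisymNoSwirlSpeedCap
import Literature.Analysis.FluidPDE.AxisymNoSwirlNashDecay
import HarnessLib

/-!
# Axisymmetric flows without swirl: the speed cap DECAYS like `t^{−3/4}`
# (Feng–Šverák 2015, Lemma 3.11 (v); Gallay–Šverák 2015, (2.14) × Lemma 5.2)

Analysis/FluidPDE proof file (theorems only; no definitions, no named facts).

Feng and Šverák bound the velocity of a viscous vortex ring (arXiv:1301.6317, proof of
Lemma 3.11 (v), p. 13, display (3.35)): "By Proposition 2.10 and 2.12,
`‖u(t)‖_{L^∞} ≲ ‖rω(t)‖_{L¹}^{1/4} ‖ω(t)/r‖_{L¹}^{1/4} ‖ω(t)/r‖_{L^∞}^{1/2}`. Then (3.31),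
`‖u(t)‖_{L^∞} ≲ κ r₀^{1/2} t^{−3/4}`, is an easy consequence of (3.35), Lemma 3.5 [the impulse],
Lemma 3.7 [`‖ω/r‖_{L¹}`] and (3.26) [`‖ω(t)/r‖_{L^∞} ≤ C_∞ t^{−3/2}`, Lemma 3.8 with `p = ∞`]."

The tree's `GallaySverak2015.speedCap` (`AxisymNoSwirlSpeedCap`) is exactly the first step, with the
UNIFORM bound `‖ω(t)/r‖_{L^∞} ≤ ‖ω₀/r‖_{L^∞}` of the maximum principle: for a Tao-class solution
(`ν = 1`) from an axisymmetric swirl-free datum with `0 ≤ η₀ = ω_θ/r ≤ M`, `η₀ ∈ L¹`, `r²η₀ ∈ L¹`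
(`A = ∫η₀ dx`, `𝓘 = ∫r²η₀ dx`), `‖u(t, x)‖ ≤ C √(√(A𝓘) · M)` for all `t`. Feeding instead
Lemma 5.2 / Lemma 3.8 for `p = ∞` (the tree's `IsTaoSolutionOn.abs_angVortQuot_le_nash_of_datum`,
`AxisymNoSwirlNashDecay`: `‖η(t)‖_{L^∞} ≤ C_K A t^{−3/2}`, `C_K = (3K₁²/2)^{3/2}`) gives the printed
decay:

* `GallaySverak2015.speedCap_decay` — **unconditional, decaying speed cap**: with the absolute
  constant `C` of `GallaySverak2015.VelocitySupBound_holds` ((2.14)), for every such solution, every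
  `t ∈ (0, T]` and `x`,
  `‖u(t, x)‖ ≤ C √( √(A 𝓘) · C_K A t^{−3/2} )` `= C C_K^{1/2} A^{3/4} 𝓘^{1/4} t^{−3/4}`
  (Feng–Šverák's `κ r₀^{1/2} t^{−3/4}`: `A ∼ κ`, `𝓘 ∼ κ r₀²`); no `L^∞` hypothesis on `η₀` is needed.

What is NOT here: the optimal `t^{−1/2}` decay (1.12) of Gallay–Šverák (the tree's named fact
`GallaySverak2015.VelocitySupDecay`, which needs Prop. 5.3, i.e. `‖ω_θ(t)‖_{L^∞}` rather than
`‖ω_θ(t)/r‖_{L^∞}`).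

## Mathlib / tree search

Tree (all used): `GallaySverak2015.VelocitySupBound_holds` (`AxisymBiotSavartSupBound`),
`IsTaoSolutionOn.integrable_curl_and_integral_norm_curl_le_of_datum` (`AxisymNoSwirlSpeedCap`),
`IsTaoSolutionOn.abs_angVortQuot_le_nash_of_datum` (`AxisymNoSwirlNashDecay`),
`norm_curl_eq_cylRadius_mul_abs_angVortQuot`, `curl_toroidal_of_hasNoSwirl`,
`IsTaoSolutionOn.biotSavart_curl_eq` (`AxisymNoSwirlScaleInvariantBounds`).
`lean search 'speedCap_decay|SpeedCapDecay'` (2026-08-27): nothing.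

## References

* H. Feng, V. Šverák, *On the Cauchy problem for axi-symmetric vortex rings*, Arch. Ration. Mech.
  Anal. 215 (2015) 89–123 = arXiv:1301.6317, Lemma 3.11 (v) (3.31) and its proof (3.35)
  (arXiv pp. 12–13). [FengSverak2015]
* Th. Gallay, V. Šverák, *Remarks on the Cauchy problem for the axisymmetric Navier–Stokes
  equations*, Confluentes Math. 7 (2015) 67–92 = arXiv:1510.01036, Prop. 2.6 (2.14) (p. 8),
  Lemma 5.1, Lemma 5.2 (p. 16), Lemma 6.4 (p. 19). [GallaySverak2016]
-/

noncomputable section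

open MeasureTheory Set Function Filter Topology
open scoped RealInnerProductSpace ENNReal NNReal ContDiff

namespace Literature.Analysis.FluidPDE

section SpeedCapDecay

variable {T : ℝ} {u₀ : EuclideanSpace ℝ (Fin 3) → EuclideanSpace ℝ (Fin 3)}
  {u : ℝ → EuclideanSpace ℝ (Fin 3) → EuclideanSpace ℝ (Fin 3)}
  {p : ℝ → EuclideanSpace ℝ (Fin 3) → ℝ}

/-- **The decaying speed cap from the two Gallay–Šverák estimates** ((2.14) as the hypothesis
`VelocitySupBound`; Lemma 5.2 `p = ∞` and Lemma 6.4 as tree theorems): for a Tao-class solution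
`(u, p)` on `[0, T]` (`0 < T`, `ν = 1`) from an axisymmetric swirl-free datum `u₀` with
`0 ≤ η₀ = angVortQuot u₀`, `η₀ ∈ L¹(ℝ³)`, `r²η₀ ∈ L¹(ℝ³)`, every `t ∈ (0, T]` and `x`:
`‖u(t, x)‖ ≤ C √( √((∫η₀)(∫r²η₀)) · (3K₁²/2)^{3/2} (∫η₀) t^{−3/2} )`, `C` the constant of (2.14),
`K₁ = max(K_GNS, 1)` — Feng–Šverák's (3.35) `‖u‖_∞ ≲ ‖rω‖₁^{1/4}‖ω/r‖₁^{1/4}‖ω/r‖_∞^{1/2}` with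
`‖ω(t)‖_{L¹} ≤ √(∫η₀ ∫r²η₀)` (`…integrable_curl_and_integral_norm_curl_le_of_datum`) and
`‖ω(t)/r‖_∞ ≤ C_K (∫η₀) t^{−3/2}` (`…abs_angVortQuot_le_nash_of_datum`).
[cite: FengSverak2015, Lemma 3.11 (v) (3.31) and proof (3.35) (arXiv pp. 12–13); GallaySverak2016, Prop. 2.6 (2.14) (arXiv p. 8) with Lemma 5.2 (p. 16) and Lemma 6.4 (p. 19)] -/
theorem speedCap_decay_of_fact (hBS : GallaySverak2015.VelocitySupBound) :
    ∃ C : ℝ, 0 ≤ C ∧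
      ∀ ⦃T : ℝ⦄ ⦃u₀ : EuclideanSpace ℝ (Fin 3) → EuclideanSpace ℝ (Fin 3)⦄
        ⦃u : ℝ → EuclideanSpace ℝ (Fin 3) → EuclideanSpace ℝ (Fin 3)⦄
        ⦃p : ℝ → EuclideanSpace ℝ (Fin 3) → ℝ⦄,
        0 < T → IsTaoSolutionOn T 1 u₀ u p → IsAxisymmetric u₀ → HasNoSwirl u₀ →
        (∀ x, 0 ≤ angVortQuot u₀ x) →
        Integrable (angVortQuot u₀) → Integrable (fun x => cylRadius x ^ 2 * angVortQuot u₀ x) →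
        ∀ t ∈ Ioc 0 T, ∀ x,
          ‖u t x‖ ≤ C * Real.sqrt (Real.sqrt ((∫ y, angVortQuot u₀ y) *
            ∫ y, cylRadius y ^ 2 * angVortQuot u₀ y) *
            ((3 * (max ((SNormLESNormFDerivOfEqConst ℝ (volume : Measure (EuclideanSpace ℝ (Fin 3))) 2
              : ℝ)) 1) ^ 2 / (2 * 1)) ^ (3 / 2 : ℝ) * (∫ y, angVortQuot u₀ y) * t ^ (-(3 / 2 : ℝ)))) := by
  obtain ⟨C, hC0, hBS⟩ := hBS
  refine ⟨C, hC0, fun T u₀ u p hT h h0 h0' hη0 hL1 hImp t ht x => ?_⟩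
  have htI : t ∈ Icc 0 T := ⟨ht.1.le, ht.2⟩
  -- the slice at time `t`
  have hax : IsAxisymmetric (u t) := h.isAxisymmetric one_pos hT h0 t htI
  have hsw : HasNoSwirl (u t) := h.hasNoSwirl one_pos hT h0 h0' t htI
  have hu3 : ContDiff ℝ 3 (u t) := (h.classical.contDiff_velocity htI).of_le (by norm_cast)
  have hu1 : ContDiff ℝ 1 (u t) := hu3.of_le (by norm_cast)
  have hωeq : ∀ y, ‖curl (u t) y‖ = cylRadius y * |angVortQuot (u t) y| :=
    norm_curl_eq_cylRadius_mul_abs_angVortQuot hax hsw hu3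
  have hωc : Continuous (curl (u t)) := continuous_curl hu1
  -- `∫ |η₀| = ∫ η₀`
  have hAabs : ∫ y, |angVortQuot u₀ y| = ∫ y, angVortQuot u₀ y :=
    integral_congr_ae (Eventually.of_forall fun y => by simp only [abs_of_nonneg (hη0 y)])
  -- Lemma 5.2, `p = ∞`: `|η(t)| ≤ L`
  set L : ℝ := (3 * (max ((SNormLESNormFDerivOfEqConst ℝ (volume : Measure (EuclideanSpace ℝ (Fin 3))) 2
      : ℝ)) 1) ^ 2 / (2 * 1)) ^ (3 / 2 : ℝ) * (∫ y, angVortQuot u₀ y) * t ^ (-(3 / 2 : ℝ)) with hLdef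
  have hL : ∀ y, |angVortQuot (u t) y| ≤ L := fun y => by
    have := h.abs_angVortQuot_le_nash_of_datum hT one_pos h0 h0' hL1 ht y
    rwa [hAabs] at this
  have hL0 : 0 ≤ L := (abs_nonneg _).trans (hL 0)
  have hωr : ∀ y, ‖curl (u t) y‖ ≤ L * cylRadius y := fun y => by
    rw [hωeq y, mul_comm]
    exact mul_le_mul_of_nonneg_right (hL y) (cylRadius_nonneg y)
  -- `ω(t) ∈ L¹` with `∫‖ω(t)‖ ≤ √(∫η₀ ∫r²η₀)` (Lemma 5.1 + Lemma 6.4, tree)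
  obtain ⟨hωint, hAω⟩ := h.integrable_curl_and_integral_norm_curl_le_of_datum hT h0 h0' hη0 hL1 hImp htI
  -- (2.14) for `ω(t)`, and `u(t) = biotSavart ω(t)`
  have hBSt := hBS (curl (u t)) L hωc hωint (hax.curl (hu1.differentiable (by simp)))
    (fun y => (curl_toroidal_of_hasNoSwirl hax hsw hu1 y).1)
    (fun y => (curl_toroidal_of_hasNoSwirl hax hsw hu1 y).2) hωr x
  rw [h.biotSavart_curl_eq htI hωint] at hBSt
  refine hBSt.trans (mul_le_mul_of_nonneg_left (Real.sqrt_le_sqrt ?_) hC0)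
  exact mul_le_mul_of_nonneg_right hAω hL0

/-- **Feng–Šverák 2015, Lemma 3.11 (v): the speed of a swirl-free axisymmetric flow decays like
`t^{−3/4}` — unconditional** (both inputs, (2.14) `GallaySverak2015.VelocitySupBound_holds` and the
Nash decay of `ω_θ/r`, are tree theorems). There is an absolute constant `C ≥ 0` such that for every
Tao-class solution `(u, p)` of the unforced Navier–Stokes system on `[0, T] × ℝ³` (`0 < T`, `ν = 1`)
from an axisymmetric swirl-free datum `u₀` with `0 ≤ η₀ = ω_θ(0)/r`, `η₀ ∈ L¹(ℝ³)`, `r²η₀ ∈ L¹(ℝ³)`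
(`A = ∫η₀ dx = 2π‖ω₀‖_{L¹(Ω)}`, `𝓘 = ∫r²η₀ dx` the impulse), every `t ∈ (0, T]` and `x ∈ ℝ³`:

  `‖u(t, x)‖ ≤ C √( √(A 𝓘) · (3K₁²/2)^{3/2} A t^{−3/2} )`  `(= C (3K₁²/2)^{3/4} A^{3/4} 𝓘^{1/4} t^{−3/4})`,

the printed `‖u(t)‖_{L^∞} ≲ κ r₀^{1/2} t^{−3/4}` (3.31) with `A ∼ κ`, `𝓘 ∼ κ r₀²`; compare the
uniform cap `GallaySverak2015.speedCap` (`√(√(A𝓘)·‖η₀‖_∞)`), which this bound improves for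
`t ≳ (A/‖η₀‖_∞)^{2/3}`. [cite: FengSverak2015, Lemma 3.11 (v) (3.31) and proof (3.35) (arXiv pp. 12–13); GallaySverak2016, Prop. 2.6 (2.14), Lemma 5.1, Lemma 5.2, Lemma 6.4 (arXiv pp. 8, 16, 19)] -/
theorem GallaySverak2015.speedCap_decay :
    ∃ C : ℝ, 0 ≤ C ∧
      ∀ ⦃T : ℝ⦄ ⦃u₀ : EuclideanSpace ℝ (Fin 3) → EuclideanSpace ℝ (Fin 3)⦄
        ⦃u : ℝ → EuclideanSpace ℝ (Fin 3) → EuclideanSpace ℝ (Fin 3)⦄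
        ⦃p : ℝ → EuclideanSpace ℝ (Fin 3) → ℝ⦄,
        0 < T → IsTaoSolutionOn T 1 u₀ u p → IsAxisymmetric u₀ → HasNoSwirl u₀ →
        (∀ x, 0 ≤ angVortQuot u₀ x) →
        Integrable (angVortQuot u₀) → Integrable (fun x => cylRadius x ^ 2 * angVortQuot u₀ x) →
        ∀ t ∈ Ioc 0 T, ∀ x,
          ‖u t x‖ ≤ C * Real.sqrt (Real.sqrt ((∫ y, angVortQuot u₀ y) *
            ∫ y, cylRadius y ^ 2 * angVortQuot u₀ y) *
            ((3 * (max ((SNormLESNormFDerivOfEqConst ℝ (volume : Measure (EuclideanSpace ℝ (Fin 3))) 2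
              : ℝ)) 1) ^ 2 / (2 * 1)) ^ (3 / 2 : ℝ) * (∫ y, angVortQuot u₀ y) * t ^ (-(3 / 2 : ℝ)))) :=
  speedCap_decay_of_fact GallaySverak2015.VelocitySupBound_holds

end SpeedCapDecay

end Literature.Analysis.FluidPDE
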